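import Summits.ValiantsHypothesis.ValiantsHypothesis.Theorems.KPlusLogSqLawTropicalBEnvelopeCriterion
import Summits.ValiantsHypothesis.ValiantsHypothesis.Theorems.KPlusLogSqLawSymmetricDesigns
import Summits.ValiantsHypothesis.ValiantsHypothesis.Theorems.LacunarySymmetroidMatrixDescartesCensusDefs
import Summits.ValiantsHypothesis.ValiantsHypothesis.Theorems.KPlusLogSqLawTropicalBTwoRowFamily

/-!
# Tower graft line — DATA of the symmetric `m = 2` tower design (`3K − 4` alternations on every 2-tower): exponents, chain slopes,
# convex costs with crossing times `4ᵏ`, valuations, signs, chain terms; closed forms and the tower arithmetic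

Definitions-and-closed-forms file (objects only; the dominance proof and the census consequence `¬ PosRootLawOn 2 K (3K − 5) d` on every
2-tower are in the companion `…TowerGraftTowerRowTwoSym`).  LINE (B) `Cruxes/WeakLifting/Lines/tower_graft.lean` of the crux `WeakLifting`
(stmt-ValiantsHypothesis-19561), `m = 2` rung of S5; NO stub is claimed; nothing on TowerB, `WeakLifting`, Conjecture B, `MatrixDescartes`
(18050) or `VP ≠ VNP`.  No `Prop` is defined: the `def`s are the design's data (numbers and terms as functions of `K`, `d`, `k`).

THE DESIGN on a 2-tower `d` (`2dₗ < d_{l'}`, `l < l'`), `K ≥ 3` letters, format `(2, K)`, SYMMETRIC valuations/signs: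
chain of `3K − 3` terms — identity terms along the HOOK `(0,0),(0,1),…,(0,K−1),(1,K−1),…,(K−1,K−1)` of the class grid (entry `(0,0)`
carries class `x`, `(1,1)` class `y`) interleaved with the DIAGONAL transposition terms `(y,y)`, `y = 1…K−2`; slopes (`X`) in the tower's
lex order `2d₀ < d₀+d₁ < 2d₁ < d₀+d₂ < ⋯ < 2d_{K−2} < d₀+d_{K−1} < d₁+d_{K−1} < ⋯ < 2d_{K−1}`; costs (`Cst`) the chain's own convex
interpolation with crossing times `4ᵏ`; valuations `aV` (entry `(0,0)`), `cV` (entry `(1,1)`), `bV` (off-diagonal, half the even cost of the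
diagonal transposition term); signs `ε₀₀(x) = (−1)ˣ`, `ε₁₁(0) = −1`, `ε₁₁(y ≥ 1) = 1`, `ε₀₁ = ε₁₀ = 1` exactly on `1…K−2`.
Seat: prover leafhand-val-kpluslogsqlaw-1 g3, `--supports stmt-ValiantsHypothesis-19561`.  [this seat's construction; folklore technique]
-/

set_option linter.dupNamespace false
set_option autoImplicit false

namespace Summit.ValiantsHypothesis.ValiantsHypothesis.Theorems.KPlusLogSqLaw.TowerGraft

open Summit.ValiantsHypothesis.ValiantsHypothesis.Theorems.MatrixDescartes.Negative
open Summit.ValiantsHypothesis.ValiantsHypothesis.Theorems.LacunarySymmetroidMatrixDescartes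
open Summit.ValiantsHypothesis.ValiantsHypothesis.Theorems.LacunarySymmetroidMatrixDescartes.TropicalCensus
open Summit.ValiantsHypothesis.ValiantsHypothesis.Theorems.KPlusLogSqLaw.EnvelopeCriterion
open Summit.ValiantsHypothesis.ValiantsHypothesis.Theorems.KPlusLogSqLaw.TwoRowFamily (perm_two)
open Finset Polynomial

namespace TowerRowTwoSym

/-! ## 1. Data of the design (natural indices) -/

/-- exponents on natural indices (`0` beyond the support). -/
def dN (K : ℕ) (d : Fin K → ℕ) (l : ℕ) : ℤ := if h : l < K then (d ⟨l, h⟩ : ℤ) else 0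

/-- slope of chain term `k`: `2d₀; d₀+d_y, 2d_y (y = 1…K−2); d_x + d_{K−1} (x = 0…K−1)`. -/
def X (K : ℕ) (d : Fin K → ℕ) (k : ℕ) : ℤ :=
  if 2 * K ≤ k + 3 then dN K d (k + 3 - 2 * K) + dN K d (K - 1)
  else if k % 2 = 1 then dN K d 0 + dN K d ((k + 1) / 2) else 2 * dN K d (k / 2)

/-- chain costs: the convex interpolation with crossing times `4ᵏ`. -/
def Cst (K : ℕ) (d : Fin K → ℕ) : ℕ → ℤ
  | 0 => 0
  | k + 1 => Cst K d k + 4 ^ (k + 1) * (X K d (k + 1) - X K d k)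

/-- valuation of class `x` in the diagonal entry `(0,0)`. -/
def aV (K : ℕ) (d : Fin K → ℕ) (x : ℕ) : ℤ := Cst K d (2 * K - 3 + x) - Cst K d (2 * K - 3)
/-- valuation of class `y` in the diagonal entry `(1,1)`. -/
def cV (K : ℕ) (d : Fin K → ℕ) (y : ℕ) : ℤ := if y = 0 then 0 else Cst K d (2 * y - 1)
/-- valuation of class `l` in the off-diagonal entries. -/
def bV (K : ℕ) (d : Fin K → ℕ) (l : ℕ) : ℤ := Cst K d (2 * l) / 2

/-- the (symmetric) valuations. -/
def vv (K : ℕ) (d : Fin K → ℕ) : Fin 2 → Fin 2 → Fin K → ℤ := fun i j l =>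
  if i = j then (if i = 0 then aV K d l else cV K d l) else bV K d l

/-- the (symmetric) signs: `ε₀₀(x) = (−1)ˣ`, `ε₁₁(0) = −1`, `ε₁₁(y) = 1 (y ≥ 1)`, off-diagonal present exactly on `1 … K−2`. -/
def ee (K : ℕ) : Fin 2 → Fin 2 → Fin K → ℤ := fun i j l =>
  if i = j then (if i = 0 then (-1) ^ (l : ℕ) else (if (l : ℕ) = 0 then -1 else 1))
  else (if 1 ≤ (l : ℕ) ∧ (l : ℕ) + 2 ≤ K then 1 else 0)

/-- class of chain term `k` in column `0`. -/
def cls0 (K k : ℕ) : ℕ := if 2 * K ≤ k + 3 then k + 3 - 2 * K else (if k % 2 = 1 then 0 else k / 2)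
/-- class of chain term `k` in column `1`. -/
def cls1 (K k : ℕ) : ℕ := if 2 * K ≤ k + 3 then K - 1 else (if k % 2 = 1 then (k + 1) / 2 else k / 2)

/-- the column-`0` class of a chain term is a letter. -/
theorem cls0_lt {K : ℕ} (hK : 3 ≤ K) {k : ℕ} (hk : k ≤ 3 * K - 4) : cls0 K k < K := by
  unfold cls0; split_ifs <;> omega

/-- the column-`1` class of a chain term is a letter. -/
theorem cls1_lt {K : ℕ} (hK : 3 ≤ K) {k : ℕ} (_hk : k ≤ 3 * K - 4) : cls1 K k < K := by
  unfold cls1; split_ifs <;> omega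

/-- the permutation of chain term `k`: the transposition exactly at the even indices `2 ≤ k ≤ 2K − 4`. -/
def perm (K k : ℕ) : Equiv.Perm (Fin 2) := if ¬ (2 * K ≤ k + 3) ∧ k % 2 = 0 ∧ k ≠ 0 then Equiv.swap 0 1 else 1

/-- the chain. -/
def term (K : ℕ) (hK : 3 ≤ K) (k : Fin (3 * K - 4 + 1)) : Equiv.Perm (Fin 2) × (Fin 2 → Fin K) :=
  (perm K k, ![⟨cls0 K k, cls0_lt hK (by have := k.isLt; omega)⟩, ⟨cls1 K k, cls1_lt hK (by have := k.isLt; omega)⟩])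

/-! ## 2. Tower arithmetic on natural indices -/

section tower
variable {K : ℕ} {d : Fin K → ℕ} (hd : ∀ l l' : Fin K, l < l' → 2 * d l < d l')
include hd

/-- a 2-tower is strictly increasing (natural indices). -/
theorem dN_lt {l l' : ℕ} (h : l < l') (hl' : l' < K) : dN K d l < dN K d l' := by
  unfold dN
  rw [dif_pos (h.trans hl'), dif_pos hl']
  have := hd ⟨l, h.trans hl'⟩ ⟨l', hl'⟩ h
  omega

/-- the tower inequality `2 d_l < d_{l'}` (natural indices). -/
theorem dN_tower {l l' : ℕ} (h : l < l') (hl' : l' < K) : 2 * dN K d l < dN K d l' := by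
  unfold dN
  rw [dif_pos (h.trans hl'), dif_pos hl']
  have := hd ⟨l, h.trans hl'⟩ ⟨l', hl'⟩ h
  omega

/-- a 2-tower is monotone (natural indices). -/
theorem dN_le {l l' : ℕ} (h : l ≤ l') (hl' : l' < K) : dN K d l ≤ dN K d l' := by
  rcases Nat.eq_or_lt_of_le h with rfl | h
  · exact le_rfl
  · exact (dN_lt hd h hl').le

omit hd in
/-- exponents are non-negative. -/
theorem dN_nonneg (l : ℕ) : 0 ≤ dN K d l := by
  unfold dN; split_ifs <;> positivity

/-! ## 3. The chain slopes: closed forms and strict monotonicity -/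

omit hd in
/-- closed form of the odd (hook, column `0` at class `0`) chain slopes: `X (2y−1) = d₀ + d_y`. -/
theorem X_odd {y : ℕ} (hK : 3 ≤ K) (hy1 : 1 ≤ y) (hy : y ≤ K - 1) : X K d (2 * y - 1) = dN K d 0 + dN K d y := by
  unfold X
  by_cases h : 2 * K ≤ 2 * y - 1 + 3
  · rw [if_pos h]; have : y = K - 1 := by omega
    subst this; congr 1; congr 1; omega
  · rw [if_neg h, if_pos (by omega)]; congr 2; omega

omit hd in
/-- closed form of the even (diagonal transposition) chain slopes: `X (2y) = 2 d_y`. -/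
theorem X_even {y : ℕ} (hy : y + 2 ≤ K) : X K d (2 * y) = 2 * dN K d y := by
  unfold X
  rw [if_neg (by omega), if_neg (by omega)]; congr 2; omega

omit hd in
/-- closed form of the late (top-column hook) chain slopes: `X (2K−3+x) = d_x + d_{K−1}`. -/
theorem X_late {x : ℕ} (hK : 2 ≤ K) : X K d (2 * K - 3 + x) = dN K d x + dN K d (K - 1) := by
  unfold X
  rw [if_pos (by omega)]; congr 2; omega

omit hd in
/-- `X (2K−3) = d₀ + d_{K−1}`. -/
theorem X_late0 (hK : 2 ≤ K) : X K d (2 * K - 3) = dN K d 0 + dN K d (K - 1) := by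
  have h := X_late (K := K) (d := d) (x := 0) hK
  rwa [Nat.add_zero] at h

omit hd in
/-- `X 0 = 2 d₀`. -/
theorem X_zero (hK : 2 ≤ K) : X K d 0 = 2 * dN K d 0 := by
  unfold X; rw [if_neg (by omega), if_neg (by omega), Nat.zero_div]

omit hd in
/-- `Cst 0 = 0`. -/
theorem Cst_zero : Cst K d 0 = 0 := rfl

/-- **the chain slopes are strictly increasing** (this is where the tower hypothesis enters: `2d_y < d₀ + d_{y+1}`). -/
theorem X_lt_succ (hK : 3 ≤ K) {k : ℕ} (hk : k + 1 ≤ 3 * K - 4) : X K d k < X K d (k + 1) := by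
  by_cases hlate : 2 * K ≤ k + 3
  · -- both late
    obtain ⟨x, rfl⟩ : ∃ x, k = 2 * K - 3 + x := ⟨k + 3 - 2 * K, by omega⟩
    rw [show 2 * K - 3 + x + 1 = 2 * K - 3 + (x + 1) by omega, X_late (by omega), X_late (by omega)]
    have := dN_lt hd (show x < x + 1 by omega) (by omega)
    linarith
  · by_cases hb : 2 * K ≤ k + 4
    · -- boundary: k = 2K − 4 (even) → 2K − 3
      have hk' : k = 2 * (K - 2) := by omega
      have e1 : X K d k = 2 * dN K d (K - 2) := by rw [hk']; exact X_even (by omega)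
      have e2 : X K d (k + 1) = dN K d 0 + dN K d (K - 1) := by
        rw [show k + 1 = 2 * K - 3 + 0 by omega, X_late (by omega)]
      rw [e1, e2]
      have := dN_tower hd (show K - 2 < K - 1 by omega) (by omega)
      have := dN_nonneg (K := K) (d := d) 0
      linarith
    · rcases Nat.even_or_odd k with ⟨y, hy⟩ | ⟨y, hy⟩
      · -- k = 2y even early, k+1 = 2(y+1) − 1
        have e1 : X K d k = 2 * dN K d y := by rw [hy, ← two_mul]; exact X_even (by omega)
        have e2 : X K d (k + 1) = dN K d 0 + dN K d (y + 1) := by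
          rw [show k + 1 = 2 * (y + 1) - 1 by omega]; exact X_odd hK (by omega) (by omega)
        rw [e1, e2]
        have := dN_tower hd (show y < y + 1 by omega) (by omega)
        have := dN_nonneg (K := K) (d := d) 0
        linarith
      · -- k = 2y+1 odd early, k + 1 = 2(y+1) even early
        have e1 : X K d k = dN K d 0 + dN K d (y + 1) := by
          rw [hy, show 2 * y + 1 = 2 * (y + 1) - 1 by omega]; exact X_odd hK (by omega) (by omega)
        have e2 : X K d (k + 1) = 2 * dN K d (y + 1) := by
          rw [hy, show 2 * y + 1 + 1 = 2 * (y + 1) by ring]; exact X_even (by omega)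
        rw [e1, e2]
        have := dN_lt hd (show 0 < y + 1 by omega) (by omega)
        linarith

/-- the chain slopes are monotone. -/
theorem X_le_succ (hK : 3 ≤ K) : ∀ i, i + 1 ≤ 3 * K - 4 → X K d i ≤ X K d (i + 1) :=
  fun _ hi => (X_lt_succ hd hK hi).le

omit hd in
/-- the cost recursion. -/
theorem Cst_succ (k : ℕ) : Cst K d (k + 1) = Cst K d k + 4 ^ (k + 1) * (X K d (k + 1) - X K d k) := rfl

omit hd in
/-- the crossing times `4ᵏ` increase. -/
theorem four_pow_le_succ : ∀ i : ℕ, i + 1 ≤ 3 * K - 4 → (4 : ℤ) ^ i ≤ 4 ^ (i + 1) :=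
  fun i _ => pow_le_pow_right₀ (by norm_num) (by omega)

/-- telescoped bounds for the chain costs. -/
theorem Cst_sub_le (hK : 3 ≤ K) {j k : ℕ} (hjk : j ≤ k) (hk : k ≤ 3 * K - 4) :
    Cst K d k - Cst K d j ≤ 4 ^ k * (X K d k - X K d j) :=
  cost_sub_le (X K d) (Cst K d) (fun i => 4 ^ i) (3 * K - 4) (X_le_succ hd hK) four_pow_le_succ (fun i _ => Cst_succ i) j k hjk hk

/-- telescoped lower bound for the chain costs. -/
theorem le_Cst_sub (hK : 3 ≤ K) {j k : ℕ} (hjk : j ≤ k) (hk : k ≤ 3 * K - 4) :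
    4 ^ (j + 1) * (X K d k - X K d j) ≤ Cst K d k - Cst K d j :=
  le_cost_sub (X K d) (Cst K d) (fun i => 4 ^ i) (3 * K - 4) (X_le_succ hd hK) four_pow_le_succ (fun i _ => Cst_succ i) j k hjk hk

omit hd in
/-- the chain costs are even (crossing times `4ᵏ`, `k ≥ 1`). -/
theorem two_dvd_Cst : ∀ k, (2 : ℤ) ∣ Cst K d k
  | 0 => by simp [Cst]
  | k + 1 => by
    rw [Cst_succ]
    refine dvd_add (two_dvd_Cst k) (Dvd.dvd.mul_right ?_ _)
    exact Dvd.dvd.pow (by norm_num) (by omega)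

omit hd in
/-- `2·bV l = Cst (2l)` (the off-diagonal valuation is half an even chain cost). -/
theorem two_mul_bV (l : ℕ) : 2 * bV K d l = Cst K d (2 * l) := by
  unfold bV; exact Int.mul_ediv_cancel' (two_dvd_Cst _)

/-- the key late-climb bound: `4^{2K−2}·(d_x − d₀) ≤ aV x`. -/
theorem le_aV (hK : 3 ≤ K) {x : ℕ} (hx : x ≤ K - 1) : 4 ^ (2 * K - 2) * (dN K d x - dN K d 0) ≤ aV K d x := by
  unfold aV
  have h := le_Cst_sub hd hK (show 2 * K - 3 ≤ 2 * K - 3 + x by omega) (by omega)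
  rw [X_late (by omega), X_late0 (by omega), show 2 * K - 3 + 1 = 2 * K - 2 by omega] at h
  linarith

end tower

/-! ## 4. The chain terms: slopes, costs, signs -/

variable {K : ℕ}

/-- slope of a `2 × 2` term on natural indices. -/
theorem slope_two (d : Fin K → ℕ) (q : Equiv.Perm (Fin 2) × (Fin 2 → Fin K)) :
    TropicalCensus.slope d q = dN K d (q.2 0) + dN K d (q.2 1) := by
  unfold TropicalCensus.slope dN
  rw [Fin.sum_univ_two, dif_pos (q.2 0).isLt, dif_pos (q.2 1).isLt]

/-- cost of an identity term. -/
theorem cost_id (d : Fin K → ℕ) (q : Equiv.Perm (Fin 2) × (Fin 2 → Fin K)) (h : q.1 = 1) :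
    ∑ i, vv K d (q.1 i) i (q.2 i) = aV K d (q.2 0) + cV K d (q.2 1) := by
  rw [Fin.sum_univ_two, h]; simp [vv]

/-- cost of a transposition term. -/
theorem cost_swap (d : Fin K → ℕ) (q : Equiv.Perm (Fin 2) × (Fin 2 → Fin K)) (h : q.1 = Equiv.swap 0 1) :
    ∑ i, vv K d (q.1 i) i (q.2 i) = bV K d (q.2 0) + bV K d (q.2 1) := by
  rw [Fin.sum_univ_two, h]; simp [vv]

/-- sign of an identity term. -/
theorem termSign_id (q : Equiv.Perm (Fin 2) × (Fin 2 → Fin K)) (h : q.1 = 1) :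
    termSign (ee K) q = (-1) ^ ((q.2 0 : ℕ)) * (if ((q.2 1 : ℕ)) = 0 then -1 else 1) := by
  unfold termSign; rw [Fin.prod_univ_two, h]; simp [ee]

/-- sign of a transposition term. -/
theorem termSign_swap (q : Equiv.Perm (Fin 2) × (Fin 2 → Fin K)) (h : q.1 = Equiv.swap 0 1) :
    termSign (ee K) q = -(ee K 1 0 (q.2 0) * ee K 0 1 (q.2 1)) := by
  unfold termSign; rw [Fin.prod_univ_two, h, Equiv.Perm.sign_swap (by decide)]
  simp only [Equiv.swap_apply_left, Equiv.swap_apply_right, Units.val_neg, Units.val_one]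
  ring

/-- the off-diagonal sign `ε₁₀`. -/
theorem ee_off10 (l : Fin K) : ee K 1 0 l = if 1 ≤ (l : ℕ) ∧ (l : ℕ) + 2 ≤ K then 1 else 0 := by
  unfold ee; rw [if_neg (by decide)]

/-- the off-diagonal sign `ε₀₁`. -/
theorem ee_off01 (l : Fin K) : ee K 0 1 l = if 1 ≤ (l : ℕ) ∧ (l : ℕ) + 2 ≤ K then 1 else 0 := by
  unfold ee; rw [if_neg (by decide)]

/-- the valuations are symmetric. -/
theorem vv_symm (d : Fin K → ℕ) : ∀ i j l, vv K d i j l = vv K d j i l := by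
  intro i j l; unfold vv; fin_cases i <;> fin_cases j <;> simp

/-- the signs are symmetric. -/
theorem ee_symm : ∀ i j (l : Fin K), ee K i j l = ee K j i l := by
  intro i j l; unfold ee; fin_cases i <;> fin_cases j <;> simp

/-- the signs are in `{−1, 0, 1}`. -/
theorem ee_natAbs : ∀ i j (l : Fin K), (ee K i j l).natAbs ≤ 1 := by
  intro i j l; unfold ee
  split_ifs <;> simp

/-- classes of a late chain term. -/
theorem cls_late {k : ℕ} (h : 2 * K ≤ k + 3) : cls0 K k = k + 3 - 2 * K ∧ cls1 K k = K - 1 := by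
  unfold cls0 cls1; rw [if_pos h, if_pos h]; exact ⟨rfl, rfl⟩

/-- classes of an odd early chain term. -/
theorem cls_odd {k : ℕ} (h : ¬ 2 * K ≤ k + 3) (ho : k % 2 = 1) : cls0 K k = 0 ∧ cls1 K k = (k + 1) / 2 := by
  unfold cls0 cls1; rw [if_neg h, if_neg h, if_pos ho, if_pos ho]; exact ⟨rfl, rfl⟩

/-- classes of an even early chain term. -/
theorem cls_even {k : ℕ} (h : ¬ 2 * K ≤ k + 3) (he : ¬ k % 2 = 1) : cls0 K k = k / 2 ∧ cls1 K k = k / 2 := by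
  unfold cls0 cls1; rw [if_neg h, if_neg h, if_neg he, if_neg he]; exact ⟨rfl, rfl⟩

/-- `aV 0 = 0`. -/
theorem aV_zero (d : Fin K → ℕ) : aV K d 0 = 0 := by unfold aV; rw [Nat.add_zero, sub_self]

/-- `cV 0 = 0`. -/
theorem cV_zero (d : Fin K → ℕ) : cV K d 0 = 0 := by unfold cV; rw [if_pos rfl]

/-- `cV y = Cst (2y−1)` for `y ≥ 1`. -/
theorem cV_ne_zero (d : Fin K → ℕ) {y : ℕ} (hy : y ≠ 0) : cV K d y = Cst K d (2 * y - 1) := by unfold cV; rw [if_neg hy]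

end TowerRowTwoSym

end Summit.ValiantsHypothesis.ValiantsHypothesis.Theorems.KPlusLogSqLaw.TowerGraft
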